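import Summits.BirchSwinnertonDyer.BirchSwinnertonDyer.Theorems.ManinLocalTwoThreeThreeVeluAscentCongruence
import Summits.BirchSwinnertonDyer.Rank1Residual.ManinAdditive.CuspidalKummerCubeNoBlindLaws
import HarnessLib

/-!
# Edges of the `3`-adic Γ₀/Γ₁ defect law: what C3 FORCES at the Shimura kernel, and what NB₃^V forbids there

Summit `BirchSwinnertonDyer`, route `ManinLocalTwoThree` (cell bsd-f2-manin), crux C3 `ManinPrimeToThreeAtNine`
(stmt-BirchSwinnertonDyer-22968); lead p1 gen 14.  By-name consequences of `…ShimuraDefectLawAtThree` (p714388) and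
`…ThreeVeluAscentCongruence` (p715170) for the optimal `X₁(N)`/`X₀(N)` pair `(D₁, D₀)` of a class at `9 ∣ N`:

* `index_ne_nine_of_not_three_dvd'` / `velu_three_ascends_at_of_not_three_dvd` — **C3 at `D₀` (`3 ∤ c₀`) FORCES**: Shimura index
  `≠ 9`, `|c₀| = |c₁|`, and (if `Λ₁(f) ≠ Λ₀(f)`) at every `w ∈ Λ₁(f) ∖ 3Λ₀(f)` the kernel line's Vélu `3`-quotient ASCENDS — the
  `3`-adic analogue of «C2 ⟹ E-an-152» (necessity of the kernel law for the transfer at `3`);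
* `congruent_kernel_generator_of_not_three_dvd` — under C3 at `D₀`, a RATIONAL `3`-torsion point of `E♮(W₀)` sitting on the kernel
  abscissa is congruent (`9 ∣ Y₁ − 4(α/3)³`);
* `no_rational_kernel_generator_of_noAscending` — under the `c`-free optimality law NB₃^V (inline, as in
  `noBlindThreeTorsionOptimal_of_noAscendingThreeTorsionOptimal`: no optimal `W₀` at `9 ∣ N` has a rational `3`-torsion point whose
  Vélu quotient ascends), an UNTRIPLED index-`3` Shimura kernel is NEVER generated by a rational `3`-torsion point of `E♮(W₀)`:
  the kernel is `μ₃`, not `ℤ/3` («`E₀(ℚ)[3] ∩ Σ(N) = 0`» in the tree's lattice language, modulo NB₃^V and untripling).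

HONEST FRAMING: conditional edges; NB₃^V, the kernel laws and C3 stay OPEN; no Manin constant is decided; BSD is not proved.
No definitions, no named facts, no sorry.
-/

set_option autoImplicit false
-- the summit-side namespace `Summit.BirchSwinnertonDyer.BirchSwinnertonDyer.…` is the tree's (summit = sub-problem)
set_option linter.dupNamespace false

noncomputable section

open scoped Classical
open WeierstrassCurve Literature.NumberTheory.EllipticCurves Literature.NumberTheory.EllipticCurves.ModularForms
open CongruenceSubgroup Polynomial
open Summit.BirchSwinnertonDyer.Rank1Residual.ManinAdditive.CuspidalKummer
open Summit.BirchSwinnertonDyer.Rank1Residual.ManinAdditive.CuspidalKummerThree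

namespace Summit.BirchSwinnertonDyer.BirchSwinnertonDyer.Theorems.ManinLocalTwoThree

variable {W₁ W₀ : WeierstrassCurve ℚ} [W₁.IsElliptic] [W₁.IsGloballyMinimal] [W₀.IsElliptic]
  [W₀.IsGloballyMinimal] {N : ℕ} [NeZero N]

/-! ## §1 What C3 at `D₀` forces at the kernel -/

/-- **`3 ∤ c₀` ⟹ `|c₀| = |c₁|`** (ledger dichotomy at `9 ∣ N`: the tripled alternative would give `3 ∣ c₀`). -/
theorem natAbs_maninConstant₀_eq_of_not_three_dvd (D₁ : Gamma1ParametrizationData W₁ N)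
    (D₀ : ModularParametrizationData W₀ N) (hiso : IsIsogenous W₁ W₀) (h₁ : D₁.IsOptimal)
    (h₀ : ∀ z ∈ D₀.L.lattice, ∃ w ∈ periodLattice D₀.f, z = D₀.c * w) (h9 : 3 ^ 2 ∣ N)
    (hnd : ¬ (3 : ℤ) ∣ D₀.maninConstant) : D₀.maninConstant.natAbs = D₁.maninConstant.natAbs := by
  rcases natAbs_maninConstant₀_eq_or_eq_three_mul_of_nine_dvd_level D₁ D₀ hiso h₁ h₀ h9 with h | h
  · exact h
  · exfalso
    apply hnd
    have h3 : (3 : ℤ).natAbs ∣ D₀.maninConstant.natAbs := ⟨D₁.maninConstant.natAbs, by simpa using h⟩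
    exact Int.natAbs_dvd_natAbs.mp h3

/-- **C3 at `D₀` FORCES the kernel line's Vélu quotient to ASCEND**: `3 ∤ c₀`, `Λ₁(f) ≠ Λ₀(f)` ⟹ at every `w ∈ Λ₁(f) ∖ 3Λ₀(f)` the
kernel abscissa `q = ℘(c₀w/3)` is rational, a `Ψ₃`-root (shifted), and the Stevens curve `W₁` carries the ascended pair
(`81c₄(W₁) = 1440q² − 9c₄(W₀)`, `729c₆(W₁) = …`) — the `3`-adic analogue of «C2 ⟹ E-an-152». -/
theorem velu_three_ascends_at_of_not_three_dvd (D₁ : Gamma1ParametrizationData W₁ N)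
    (D₀ : ModularParametrizationData W₀ N) (hiso : IsIsogenous W₁ W₀) (h₁ : D₁.IsOptimal)
    (h₀ : ∀ z ∈ D₀.L.lattice, ∃ w ∈ periodLattice D₀.f, z = D₀.c * w) (h9 : 3 ^ 2 ∣ N)
    (hnd : ¬ (3 : ℤ) ∣ D₀.maninConstant) (hΛne : periodLatticeGamma1 D₀.f ≠ periodLattice D₀.f)
    {w : ℂ} (hw : w ∈ periodLatticeGamma1 D₀.f) (hw3 : ∀ v ∈ periodLattice D₀.f, w ≠ 3 * v) :
    ∃ q : ℚ, (q : ℂ) = D₀.L.weierstrassP ((D₀.c : ℂ) * w / 3) ∧ W₀.Ψ₃.eval (q - W₀.b₂ / 12) = 0 ∧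
      81 * W₁.c₄ = 1440 * q ^ 2 - 9 * W₀.c₄ ∧ 729 * W₁.c₆ = 60480 * q ^ 3 - 756 * W₀.c₄ * q - 27 * W₀.c₆ :=
  velu_three_ascends_at_of_natAbs_eq D₁ D₀ hiso h₁ h₀ h9
    (natAbs_maninConstant₀_eq_of_not_three_dvd D₁ D₀ hiso h₁ h₀ h9 hnd) hΛne hw hw3

/-- **Under C3 at `D₀`, a rational kernel generator is congruent**: `3 ∤ c₀`, `Λ₁(f) ≠ Λ₀(f)`, `w ∈ Λ₁(f) ∖ 3Λ₀(f)`, and a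
RATIONAL point `(X₁, Y₁)` of order `3` on `E♮(W₀)` with `X₁ = ℘(c₀w/3)` ⟹ `9 ∣ Y₁ − 4(α/3)³` in `ℤ₃`. -/
theorem congruent_kernel_generator_of_not_three_dvd (D₁ : Gamma1ParametrizationData W₁ N)
    (D₀ : ModularParametrizationData W₀ N) (hiso : IsIsogenous W₁ W₀) (h₁ : D₁.IsOptimal)
    (h₀ : ∀ z ∈ D₀.L.lattice, ∃ w ∈ periodLattice D₀.f, z = D₀.c * w) (h9 : 3 ^ 2 ∣ N)
    (hnd : ¬ (3 : ℤ) ∣ D₀.maninConstant) (hΛne : periodLatticeGamma1 D₀.f ≠ periodLattice D₀.f)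
    {w : ℂ} (hw : w ∈ periodLatticeGamma1 D₀.f) (hw3 : ∀ v ∈ periodLattice D₀.f, w ≠ 3 * v)
    {X₁ Y₁ : ℚ} (hT : IsShortThreeTorsion W₀ 1 X₁ Y₁) (hx : (X₁ : ℂ) = D₀.L.weierstrassP ((D₀.c : ℂ) * w / 3)) :
    ‖(((Y₁ - 4 * (tangentSlope W₀ 1 X₁ Y₁ / 3) ^ 3) / 9 : ℚ) : ℚ_[3])‖ ≤ 1 :=
  norm_congruence_le_one_of_untripled_index_three D₁ D₀ hiso h₁ h₀ h9
    (natAbs_maninConstant₀_eq_of_not_three_dvd D₁ D₀ hiso h₁ h₀ h9 hnd) hΛne hw hw3 hT hx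

/-! ## §2 What NB₃^V forbids at the kernel -/

/-- **Modulo NB₃^V an untripled index-`3` Shimura kernel has NO rational generator.**  With the `c`-free optimality law NB₃^V as
hypothesis (verbatim the `hV` of `noBlindThreeTorsionOptimal_of_noAscendingThreeTorsionOptimal`): for the optimal pair at `9 ∣ N`
with `|c₀| = |c₁|` and `Λ₁(f) ≠ Λ₀(f)`, no rational point `(X₁, Y₁)` of order `3` on `E♮(W₀)` has `X₁ = ℘(c₀w/3)` for a
`w ∈ Λ₁(f) ∖ 3Λ₀(f)` — the Stevens curve would carry the ascended pair of `(X₁, Y₁)` (`velu_three_ascends_at_of_natAbs_eq`),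
which NB₃^V forbids for the optimal `W₀`.  (Kernel `≅ μ₃`, not `ℤ/3`.)  CONDITIONAL on NB₃^V. -/
theorem no_rational_kernel_generator_of_noAscending
    (hV : ∀ (W : WeierstrassCurve ℚ) [W.IsElliptic] [W.IsGloballyMinimal] {N : ℕ} [NeZero N]
      (D : ModularParametrizationData W N),
      (∀ z ∈ D.L.lattice, ∃ w ∈ periodLattice D.f, z = D.c * w) → 9 ∣ N →
      ∀ X₁ Y₁ : ℚ, IsShortThreeTorsion W 1 X₁ Y₁ →
      ¬ ∃ W' : WeierstrassCurve ℚ, W'.IsElliptic ∧ W'.IsGloballyMinimal ∧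
          (3 : ℚ) ^ 4 * W'.c₄ = 1440 * X₁ ^ 2 - 9 * W.c₄ ∧
          (3 : ℚ) ^ 6 * W'.c₆ = 60480 * X₁ ^ 3 - 756 * W.c₄ * X₁ - 27 * W.c₆)
    (D₁ : Gamma1ParametrizationData W₁ N) (D₀ : ModularParametrizationData W₀ N) (hiso : IsIsogenous W₁ W₀)
    (h₁ : D₁.IsOptimal) (h₀ : ∀ z ∈ D₀.L.lattice, ∃ w ∈ periodLattice D₀.f, z = D₀.c * w) (h9 : 3 ^ 2 ∣ N)
    (heq : D₀.maninConstant.natAbs = D₁.maninConstant.natAbs)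
    (hΛne : periodLatticeGamma1 D₀.f ≠ periodLattice D₀.f)
    {w : ℂ} (hw : w ∈ periodLatticeGamma1 D₀.f) (hw3 : ∀ v ∈ periodLattice D₀.f, w ≠ 3 * v)
    {X₁ Y₁ : ℚ} (hT : IsShortThreeTorsion W₀ 1 X₁ Y₁) :
    (X₁ : ℂ) ≠ D₀.L.weierstrassP ((D₀.c : ℂ) * w / 3) := by
  intro hx
  obtain ⟨q, hq, -, hA3, hB3⟩ := velu_three_ascends_at_of_natAbs_eq D₁ D₀ hiso h₁ h₀ h9 heq hΛne hw hw3
  have hqX : q = X₁ := by exact_mod_cast hq.trans hx.symm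
  subst hqX
  exact hV W₀ D₀ h₀ (by simpa using h9) q Y₁ hT
    ⟨W₁, inferInstance, inferInstance, by linear_combination hA3, by linear_combination hB3⟩

/-- **Modulo NB₃^V and C3 at `D₀`: the Shimura kernel at `3` has no rational generator** (§1 + §2). -/
theorem no_rational_kernel_generator_of_noAscending_of_not_three_dvd
    (hV : ∀ (W : WeierstrassCurve ℚ) [W.IsElliptic] [W.IsGloballyMinimal] {N : ℕ} [NeZero N]
      (D : ModularParametrizationData W N),
      (∀ z ∈ D.L.lattice, ∃ w ∈ periodLattice D.f, z = D.c * w) → 9 ∣ N →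
      ∀ X₁ Y₁ : ℚ, IsShortThreeTorsion W 1 X₁ Y₁ →
      ¬ ∃ W' : WeierstrassCurve ℚ, W'.IsElliptic ∧ W'.IsGloballyMinimal ∧
          (3 : ℚ) ^ 4 * W'.c₄ = 1440 * X₁ ^ 2 - 9 * W.c₄ ∧
          (3 : ℚ) ^ 6 * W'.c₆ = 60480 * X₁ ^ 3 - 756 * W.c₄ * X₁ - 27 * W.c₆)
    (D₁ : Gamma1ParametrizationData W₁ N) (D₀ : ModularParametrizationData W₀ N) (hiso : IsIsogenous W₁ W₀)
    (h₁ : D₁.IsOptimal) (h₀ : ∀ z ∈ D₀.L.lattice, ∃ w ∈ periodLattice D₀.f, z = D₀.c * w) (h9 : 3 ^ 2 ∣ N)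
    (hnd : ¬ (3 : ℤ) ∣ D₀.maninConstant) (hΛne : periodLatticeGamma1 D₀.f ≠ periodLattice D₀.f)
    {w : ℂ} (hw : w ∈ periodLatticeGamma1 D₀.f) (hw3 : ∀ v ∈ periodLattice D₀.f, w ≠ 3 * v)
    {X₁ Y₁ : ℚ} (hT : IsShortThreeTorsion W₀ 1 X₁ Y₁) :
    (X₁ : ℂ) ≠ D₀.L.weierstrassP ((D₀.c : ℂ) * w / 3) :=
  no_rational_kernel_generator_of_noAscending hV D₁ D₀ hiso h₁ h₀ h9
    (natAbs_maninConstant₀_eq_of_not_three_dvd D₁ D₀ hiso h₁ h₀ h9 hnd) hΛne hw hw3 hT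

end Summit.BirchSwinnertonDyer.BirchSwinnertonDyer.Theorems.ManinLocalTwoThree

end
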